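import Summits.CriticalPhenomena.PercolationContinuityZ3.Theorems.PercNearOneGluingNoHeavyConstsTwoCopyIteration
import Summits.CriticalPhenomena.PercolationContinuityZ3.Theorems.PercNearOneGluingNoHeavyConstsTwoCopyAveraging
import Summits.CriticalPhenomena.PercolationContinuityZ3.Theorems.PercNearOneGluingNoHeavyLowerTailCovTauBridge
import HarnessLib

/-!
# Two-copy BHK, III: THE MEASURE-LEVEL HARD-CORE HARRIS INEQUALITY for every hard-core set `N` — PROVED

builds on p205010 (kernel theorem, internal audit signed; external expert review pending).  Support file (`--supports
stmt-CriticalPhenomena-4575`), lead seat `prim-nh-lead-4575` (gen 105); memo `run/shared/lean/prim/prim-nh-lead-4575/LEAD-GEN105.md` §1(6).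
Theorems only; no sorries; standard axioms; default heartbeats.

* `twoCopy_hardCore_measure` — **THEOREM.**  For two INDEPENDENT copies `ω₀, ω₁ ~ μ = prodBernoulli w` of bond percolation on a
  finite vertex type (any weights), a source set `S`, a hard-core set `N`, `HC = {no vertex of N is joined to S in both copies}`
  and increasing events `P, Q` of the union cluster `C_S`:
  `(μ ⊗ μ){HC, P(C_S ω₀), Q(C_S ω₁)} ≤ (μ ⊗ μ){HC, P(C_S ω₀), Q(C_S ω₀)}`.
  `N = ∅`: Harris' inequality.  `N = {v}`: `Consts.hardCoreHarris_measure_one`.  General `N`: new (lead gen 105, pencil §1(6);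
  this file is its kernel form).  It is the Linusson/Bernstein sum over all folding fibres of the `T = ∅` slice of
  `Consts.HardCoreBHK` ("hard-core Harris"), which by `Consts.HardCoreReduction.hardCoreBHK_iff_hardCoreHarris` is equivalent to
  the whole fibrewise van den Berg–Häggström–Kahn conjecture `Consts.HardCoreBHK ⟹ Consts.FibrewiseBHK` (PA-BERN): so, exactly as
  for BHK's Theorem 1.3 itself, the MEASURE-LEVEL statement is a theorem and the FIBREWISE one is the open problem.
* Proof (`hardCore_cross_le_sum` + `prod_real_setOf_eq_sum` + `kernelMass_eq_zero_of_degenerate`): the generic iteration of part I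
  (`twoCopy_cross_le`: `B(F,G) ≥ B(TF,TG) ≥ … → 0` by the Doeblin contraction with `δ = μ(S ↮ N)`) with the ingredients of
  part II (BHK's Theorem 1.3 seen from every `ω`, `T` exchanging increasing and decreasing cluster functions); the degenerate
  weights `μ(S ↮ N) = 0` are handled by Harris (`μ(ω) μ(S ↮ Z(ω)) ≤ μ(S ↮ N ∖ Z(ω)) μ(S ↮ Z(ω)) ≤ μ(S ↮ N) = 0`).
[cite: VandenbergHaggstromKahn2005, Thm. 1.3 (p. 6) with Remark 1 (p. 5)] [cite: Harris1960, Lemma 4.1] [cite: Linusson2011, Prop. 2.6]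
-/

noncomputable section

namespace Summit.CriticalPhenomena.PercolationContinuityZ3.Theorems

open MeasureTheory Set Literature.Probability.LatticeModels Literature.Probability.Percolation
open Literature.Probability.Percolation.BHK2006 (weight weight_nonneg integral_prodBernoulli_eq_sum ind_mono ind_le_one)
open Literature.Probability.Percolation.DecisionTree (ind ind_of_mem ind_of_not_mem ind_nonneg)
open Literature.Probability.Percolation.TwoSetConditionalAssociation (setOf_mem_or_exists_mem_biUnion_openEdgeCluster)
open scoped Classical

namespace Consts.TwoCopy

variable {V : Type*} [Fintype V]

/-- **Cross-copy ≤ same-copy for the hard-core kernel, sum form** (non-degenerate case `μ(S ↮ N) > 0`): for increasing cluster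
events `P, Q`, `∑_ω w(ω) 1_P(C_S ω) · μ(Q(C_S) ∩ compatible with ω) ≤ ∑_ω w(ω) μ(compatible with ω) 1_P(C_S ω) 1_Q(C_S ω)`.
[cite: VandenbergHaggstromKahn2005, Thm. 1.3 (p. 6)] -/
theorem hardCore_cross_le_sum (w : Sym2 V → unitInterval) (S N : Set V)
    (χ : BondConfig V → BondConfig V → ℝ)
    (hχ : ∀ ω η, χ ω η = if (∀ v ∈ N, ¬ ((∃ s ∈ S, (openGraph ω).Reachable s v) ∧
      (∃ s ∈ S, (openGraph η).Reachable s v))) then 1 else 0)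
    (hδ : 0 < ∑ η, weight (fun e => (w e : ℝ)) η *
      ind {η' : BondConfig V | ∀ s ∈ S, ∀ t ∈ N, ¬ (openGraph η').Reachable s t} η)
    (P Q : Set (Sym2 V) → Prop) (hP : ∀ ⦃C C' : Set (Sym2 V)⦄, C ⊆ C' → P C → P C')
    (hQ : ∀ ⦃C C' : Set (Sym2 V)⦄, C ⊆ C' → Q C → Q C') :
    ∑ ω, weight (fun e => (w e : ℝ)) ω * ((if P (⋃ s ∈ S, openEdgeCluster ω s) then (1 : ℝ) else 0) *
        ∑ η, weight (fun e => (w e : ℝ)) η * ((if Q (⋃ s ∈ S, openEdgeCluster η s) then (1 : ℝ) else 0) * χ ω η)) ≤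
      ∑ ω, weight (fun e => (w e : ℝ)) ω * (∑ η, weight (fun e => (w e : ℝ)) η * χ ω η) *
        ((if P (⋃ s ∈ S, openEdgeCluster ω s) then (1 : ℝ) else 0) *
          (if Q (⋃ s ∈ S, openEdgeCluster ω s) then (1 : ℝ) else 0)) := by
  have hw0 : ∀ ω, 0 ≤ weight (fun e => (w e : ℝ)) ω := weight_nonneg (fun e => (w e).2.1) (fun e => (w e).2.2)
  have hsym : ∀ ω η, χ ω η = χ η ω := fun ω η => (kernel_symm_le_one S N χ hχ ω η).1
  have hle1 : ∀ ω η, χ ω η ≤ 1 := fun ω η => (kernel_symm_le_one S N χ hχ ω η).2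
  have hχs := ind_notReachable_le_kernel S N χ hχ
  have hr : ∀ ω, 0 < ∑ η, weight (fun e => (w e : ℝ)) η * χ ω η := fun ω =>
    hδ.trans_le (Finset.sum_le_sum fun η _ => mul_le_mul_of_nonneg_left (hχs ω η) (hw0 η))
  -- the averaging operator
  set T : (BondConfig V → ℝ) → BondConfig V → ℝ := fun X ω =>
    (∑ η, weight (fun e => (w e : ℝ)) η * (X η * χ ω η)) / (∑ η, weight (fun e => (w e : ℝ)) η * χ ω η) with hTdef
  have hT : ∀ (X : BondConfig V → ℝ) ω, T X ω * (∑ η, weight (fun e => (w e : ℝ)) η * χ ω η) =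
      ∑ η, weight (fun e => (w e : ℝ)) η * (X η * χ ω η) := fun X ω => by
    simp only [hTdef]
    exact div_mul_cancel₀ _ (hr ω).ne'
  -- the classes of increasing / decreasing cluster functions
  refine twoCopy_cross_le (fun ω => weight (fun e => (w e : ℝ)) ω) hw0 (CovTau.sum_weight_coe_eq_one w) χ hsym hle1
    (fun η => ind {η' : BondConfig V | ∀ s ∈ S, ∀ t ∈ N, ¬ (openGraph η').Reachable s t} η)
    (fun η => ind_nonneg _ η) hχs _ rfl hδ
    (fun X => ∃ φ : Set (Sym2 V) → ℝ, Monotone φ ∧ X = fun ω => φ (⋃ s ∈ S, openEdgeCluster ω s))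
    (fun X => ∃ φ : Set (Sym2 V) → ℝ, Antitone φ ∧ X = fun ω => φ (⋃ s ∈ S, openEdgeCluster ω s))
    T hT ?_ ?_ ?_ ?_ ?_ _ _ ⟨fun E => if P E then 1 else 0, ?_, rfl⟩ ⟨fun E => if Q E then 1 else 0, ?_, rfl⟩
  · rintro F ⟨φ, hφ, rfl⟩
    exact averaging_monotone_to_antitone w S N χ hχ hδ T hT φ hφ
  · rintro F ⟨φ, hφ, rfl⟩
    exact averaging_antitone_to_monotone w S N χ hχ hδ T hT φ hφ
  · rintro F G ⟨φ, hφ, rfl⟩ ⟨ψ, hψ, rfl⟩ ω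
    exact hardCore_PA w S N χ hχ φ ψ hφ hψ ω
  · rintro F G ⟨φ, hφ, rfl⟩ ⟨ψ, hψ, rfl⟩ ω
    have h := hardCore_PA w S N χ hχ (fun E => -φ E) (fun E => -ψ E)
      (fun _ _ hab => neg_le_neg (hφ hab)) (fun _ _ hab => neg_le_neg (hψ hab)) ω
    have e1 : ∀ θ : Set (Sym2 V) → ℝ, ∑ η, weight (fun e => (w e : ℝ)) η *
        (-θ (⋃ s ∈ S, openEdgeCluster η s) * χ ω η) =
        -∑ η, weight (fun e => (w e : ℝ)) η * (θ (⋃ s ∈ S, openEdgeCluster η s) * χ ω η) := fun θ => by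
      rw [← Finset.sum_neg_distrib]
      exact Finset.sum_congr rfl fun η _ => by ring
    have e3 : ∑ η, weight (fun e => (w e : ℝ)) η *
        (-φ (⋃ s ∈ S, openEdgeCluster η s) * -ψ (⋃ s ∈ S, openEdgeCluster η s) * χ ω η) =
        ∑ η, weight (fun e => (w e : ℝ)) η *
          (φ (⋃ s ∈ S, openEdgeCluster η s) * ψ (⋃ s ∈ S, openEdgeCluster η s) * χ ω η) :=
      Finset.sum_congr rfl fun η _ => by ring
    rw [e1, e1, e3, neg_mul_neg] at h
    exact h
  · rintro F G ⟨φ, hφ, rfl⟩ ⟨ψ, hψ, rfl⟩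
    exact ⟨fun E => φ E - ψ E, fun _ _ hab => sub_le_sub (hφ hab) (hψ hab), rfl⟩
  · intro E E' hEE'
    by_cases h : P E
    · simp only [if_pos h, if_pos (hP hEE' h), le_refl]
    · simp only [if_neg h]
      split_ifs <;> norm_num
  · intro E E' hEE'
    by_cases h : Q E
    · simp only [if_pos h, if_pos (hQ hEE' h), le_refl]
    · simp only [if_neg h]
      split_ifs <;> norm_num

/-- A point mass of `prodBernoulli w` is the product weight. [folklore] -/
theorem real_singleton_eq_weight (w : Sym2 V → unitInterval) (ω : BondConfig V) :
    (prodBernoulli w).real {ω} = weight (fun e => (w e : ℝ)) ω := by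
  rw [prodBernoulli_real_eq_sum_weight_ind,
    Finset.sum_eq_single ω (fun a _ ha => by rw [ind_of_not_mem (by simpa using ha), mul_zero])
      (fun h => absurd (Finset.mem_univ ω) h),
    ind_of_mem (mem_singleton ω), mul_one]

/-- **Two independent copies as a double weighted sum**: the product measure of a relation. [folklore] -/
theorem prod_real_setOf_eq_sum (w : Sym2 V → unitInterval) (E : BondConfig V → BondConfig V → Prop) :
    ((prodBernoulli w).prod (prodBernoulli w)).real {x : BondConfig V × BondConfig V | E x.1 x.2} =
      ∑ ω, weight (fun e => (w e : ℝ)) ω *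
        ∑ η, weight (fun e => (w e : ℝ)) η * (if E ω η then (1 : ℝ) else 0) := by
  have hdec : {x : BondConfig V × BondConfig V | E x.1 x.2} =
      ⋃ ω ∈ (Finset.univ : Finset (BondConfig V)), ({ω} : Set (BondConfig V)) ×ˢ {η | E ω η} := by
    ext x
    simp only [mem_setOf_eq, mem_iUnion, Finset.mem_univ, mem_prod, mem_singleton_iff, exists_prop, true_and]
    constructor
    · intro h
      exact ⟨x.1, rfl, h⟩
    · rintro ⟨i, hi, h⟩
      rw [hi]; exact h
  have hdisj : Set.PairwiseDisjoint (↑(Finset.univ : Finset (BondConfig V)))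
      (fun ω => ({ω} : Set (BondConfig V)) ×ˢ {η | E ω η}) := by
    intro ω _ ω' _ hne
    refine Set.disjoint_left.2 fun x hx hx' => hne ?_
    rw [mem_prod, mem_singleton_iff] at hx hx'
    exact hx.1.symm.trans hx'.1
  rw [measureReal_def, hdec, measure_biUnion_finset hdisj
    (fun ω _ => (measurableSet_singleton ω).prod MeasurableSet.of_discrete),
    ENNReal.toReal_sum (fun ω _ => measure_ne_top _ _)]
  refine Finset.sum_congr rfl fun ω _ => ?_
  rw [Measure.prod_prod, ENNReal.toReal_mul, ← measureReal_def, ← measureReal_def, real_singleton_eq_weight,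
    prodBernoulli_real_eq_sum_weight_ind]
  rfl

/-- **Degenerate case**: if `μ(S ↮ N) = 0` then no configuration of positive weight is compatible with positive mass
(Harris: `μ(ω) μ(S ↮ Z(ω)) ≤ μ(S ↮ N ∖ Z(ω)) μ(S ↮ Z(ω)) ≤ μ(S ↮ N)`). [cite: Harris1960, Lemma 4.1] -/
theorem kernelMass_eq_zero_of_degenerate (w : Sym2 V → unitInterval) (S N : Set V)
    (χ : BondConfig V → BondConfig V → ℝ)
    (hχ : ∀ ω η, χ ω η = if (∀ v ∈ N, ¬ ((∃ s ∈ S, (openGraph ω).Reachable s v) ∧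
      (∃ s ∈ S, (openGraph η).Reachable s v))) then 1 else 0)
    (hδ0 : ∑ η, weight (fun e => (w e : ℝ)) η *
      ind {η' : BondConfig V | ∀ s ∈ S, ∀ t ∈ N, ¬ (openGraph η').Reachable s t} η = 0)
    (ω : BondConfig V) :
    weight (fun e => (w e : ℝ)) ω * ∑ η, weight (fun e => (w e : ℝ)) η * χ ω η = 0 := by
  set A : Set (BondConfig V) := {η' : BondConfig V | ∀ s ∈ S,
    ∀ t ∈ {v | v ∈ N ∧ ¬ ∃ s ∈ S, (openGraph ω).Reachable s v}, ¬ (openGraph η').Reachable s t} with hA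
  set B : Set (BondConfig V) := {η' : BondConfig V | ∀ s ∈ S,
    ∀ t ∈ {v | v ∈ N ∧ ∃ s ∈ S, (openGraph ω).Reachable s v}, ¬ (openGraph η').Reachable s t} with hB
  have hωA : ω ∈ A := fun s hs t ht hr => ht.2 ⟨s, hs, hr⟩
  have hAB : A ∩ B ⊆ {η' : BondConfig V | ∀ s ∈ S, ∀ t ∈ N, ¬ (openGraph η').Reachable s t} := by
    rintro η ⟨hA', hB'⟩ s hs t ht hr
    by_cases h : ∃ s ∈ S, (openGraph ω).Reachable s t
    · exact hB' s hs t ⟨ht, h⟩ hr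
    · exact hA' s hs t ⟨ht, h⟩ hr
  have hw0 : ∀ ω, 0 ≤ weight (fun e => (w e : ℝ)) ω := weight_nonneg (fun e => (w e).2.1) (fun e => (w e).2.2)
  have hr : ∑ η, weight (fun e => (w e : ℝ)) η * χ ω η = (prodBernoulli w).real B := by
    rw [prodBernoulli_real_eq_sum_weight_ind]
    refine Finset.sum_congr rfl fun η _ => ?_
    rw [hχ]
    by_cases h : η ∈ B
    · rw [ind_of_mem h, if_pos ((hardCore_iff S N ω η).2 h)]
    · rw [ind_of_not_mem h, if_neg (fun h' => h ((hardCore_iff S N ω η).1 h'))]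
  have h1 : weight (fun e => (w e : ℝ)) ω ≤ (prodBernoulli w).real A := by
    rw [← real_singleton_eq_weight]
    exact measureReal_mono (Set.singleton_subset_iff.2 hωA)
  have h2 : (prodBernoulli w).real A * (prodBernoulli w).real B ≤ (prodBernoulli w).real (A ∩ B) :=
    prodBernoulli_harris_lower w (isLowerSet_notReachable S _) (isLowerSet_notReachable S _)
      MeasurableSet.of_discrete MeasurableSet.of_discrete
  have h3 : (prodBernoulli w).real (A ∩ B) ≤ 0 := by
    calc (prodBernoulli w).real (A ∩ B)
        ≤ (prodBernoulli w).real {η' : BondConfig V | ∀ s ∈ S, ∀ t ∈ N, ¬ (openGraph η').Reachable s t} :=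
          measureReal_mono hAB
      _ = 0 := by rw [prodBernoulli_real_eq_sum_weight_ind]; exact hδ0
  have h4 : 0 ≤ weight (fun e => (w e : ℝ)) ω * ∑ η, weight (fun e => (w e : ℝ)) η * χ ω η :=
    mul_nonneg (hw0 ω) (Finset.sum_nonneg fun η _ => mul_nonneg (hw0 η)
      (le_trans (ind_nonneg _ η) (ind_notReachable_le_kernel S N χ hχ ω η)))
  rw [hr] at h4 ⊢
  nlinarith [measureReal_nonneg (μ := prodBernoulli w) (s := B)]

/-- **TWO-COPY BHK / measure-level hard-core Harris (lead gen 105, §1(6)).**  Two INDEPENDENT copies `ω₀, ω₁ ~ prodBernoulli w`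
of bond percolation on a finite vertex type, a source set `S`, a hard-core set `N` and the event
`HC = {no vertex of N is joined to S in both copies}`; then for increasing events `P, Q` of the union cluster `C_S`,
`μ⊗μ(HC ∧ P(C_S ω₀) ∧ Q(C_S ω₁)) ≤ μ⊗μ(HC ∧ P(C_S ω₀) ∧ Q(C_S ω₀))` — pairing `P` with `Q` of a compatible independent copy
gives at most pairing them in the same copy.  `N = ∅` is Harris' inequality; `N = {v}` is `Consts.hardCoreHarris_measure_one`;
this is the measure-level (Linusson-summed) form of the `T = ∅` slice of `Consts.HardCoreBHK`, whose fibrewise form is open.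
Proof: BHK's Theorem 1.3 with the random repelled set `Z(ω₁) = N ∩ V(C_S ω₁)`, the averaging operator
`(T F)(ω) = E[F | S ↮ Z(ω)]` (which exchanges increasing and decreasing cluster functions), `B(F,G) ≥ B(TF,TG)` and a Doeblin
contraction (`…ConstsTwoCopyIteration.lean`); degenerate weights (`μ(S ↮ N) = 0`) by Harris.
[cite: VandenbergHaggstromKahn2005, Thm. 1.3 (p. 6) with Remark 1 (p. 5)] [cite: Harris1960, Lemma 4.1] -/
theorem twoCopy_hardCore_measure (w : Sym2 V → unitInterval) (S N : Set V) (P Q : Set (Sym2 V) → Prop)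
    (hP : ∀ ⦃C C' : Set (Sym2 V)⦄, C ⊆ C' → P C → P C') (hQ : ∀ ⦃C C' : Set (Sym2 V)⦄, C ⊆ C' → Q C → Q C') :
    ((prodBernoulli w).prod (prodBernoulli w)).real
        {x : BondConfig V × BondConfig V |
          (∀ v ∈ N, ¬ ((∃ s ∈ S, (openGraph x.1).Reachable s v) ∧ (∃ s ∈ S, (openGraph x.2).Reachable s v))) ∧
            P (⋃ s ∈ S, openEdgeCluster x.1 s) ∧ Q (⋃ s ∈ S, openEdgeCluster x.2 s)} ≤
      ((prodBernoulli w).prod (prodBernoulli w)).real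
        {x : BondConfig V × BondConfig V |
          (∀ v ∈ N, ¬ ((∃ s ∈ S, (openGraph x.1).Reachable s v) ∧ (∃ s ∈ S, (openGraph x.2).Reachable s v))) ∧
            P (⋃ s ∈ S, openEdgeCluster x.1 s) ∧ Q (⋃ s ∈ S, openEdgeCluster x.1 s)} := by
  have hw0 : ∀ ω, 0 ≤ weight (fun e => (w e : ℝ)) ω := weight_nonneg (fun e => (w e).2.1) (fun e => (w e).2.2)
  have hite : ∀ (A B C : Prop) [Decidable A] [Decidable B] [Decidable C] [Decidable (A ∧ B ∧ C)],
      (if A ∧ B ∧ C then (1 : ℝ) else 0) =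
        (if B then (1 : ℝ) else 0) * ((if C then (1 : ℝ) else 0) * (if A then (1 : ℝ) else 0)) := by
    intro A B C _ _ _ _
    by_cases hA : A <;> by_cases hB : B <;> by_cases hC : C <;> simp [hA, hB, hC]
  have e1 : ((prodBernoulli w).prod (prodBernoulli w)).real
      {x : BondConfig V × BondConfig V |
        (∀ v ∈ N, ¬ ((∃ s ∈ S, (openGraph x.1).Reachable s v) ∧ (∃ s ∈ S, (openGraph x.2).Reachable s v))) ∧
          P (⋃ s ∈ S, openEdgeCluster x.1 s) ∧ Q (⋃ s ∈ S, openEdgeCluster x.2 s)} =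
      ∑ ω, weight (fun e => (w e : ℝ)) ω * ((if P (⋃ s ∈ S, openEdgeCluster ω s) then (1 : ℝ) else 0) *
        ∑ η, weight (fun e => (w e : ℝ)) η * ((if Q (⋃ s ∈ S, openEdgeCluster η s) then (1 : ℝ) else 0) *
          (if (∀ v ∈ N, ¬ ((∃ s ∈ S, (openGraph ω).Reachable s v) ∧ (∃ s ∈ S, (openGraph η).Reachable s v)))
            then (1 : ℝ) else 0))) := by
    rw [prod_real_setOf_eq_sum w (fun ω η =>
      (∀ v ∈ N, ¬ ((∃ s ∈ S, (openGraph ω).Reachable s v) ∧ (∃ s ∈ S, (openGraph η).Reachable s v))) ∧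
        P (⋃ s ∈ S, openEdgeCluster ω s) ∧ Q (⋃ s ∈ S, openEdgeCluster η s))]
    refine Finset.sum_congr rfl fun ω _ => ?_
    rw [Finset.mul_sum, Finset.mul_sum, Finset.mul_sum]
    exact Finset.sum_congr rfl fun η _ => by rw [hite]; ring
  have e2 : ((prodBernoulli w).prod (prodBernoulli w)).real
      {x : BondConfig V × BondConfig V |
        (∀ v ∈ N, ¬ ((∃ s ∈ S, (openGraph x.1).Reachable s v) ∧ (∃ s ∈ S, (openGraph x.2).Reachable s v))) ∧
          P (⋃ s ∈ S, openEdgeCluster x.1 s) ∧ Q (⋃ s ∈ S, openEdgeCluster x.1 s)} =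
      ∑ ω, weight (fun e => (w e : ℝ)) ω * (∑ η, weight (fun e => (w e : ℝ)) η *
          (if (∀ v ∈ N, ¬ ((∃ s ∈ S, (openGraph ω).Reachable s v) ∧ (∃ s ∈ S, (openGraph η).Reachable s v)))
            then (1 : ℝ) else 0)) *
        ((if P (⋃ s ∈ S, openEdgeCluster ω s) then (1 : ℝ) else 0) *
          (if Q (⋃ s ∈ S, openEdgeCluster ω s) then (1 : ℝ) else 0)) := by
    rw [prod_real_setOf_eq_sum w (fun ω η =>
      (∀ v ∈ N, ¬ ((∃ s ∈ S, (openGraph ω).Reachable s v) ∧ (∃ s ∈ S, (openGraph η).Reachable s v))) ∧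
        P (⋃ s ∈ S, openEdgeCluster ω s) ∧ Q (⋃ s ∈ S, openEdgeCluster ω s))]
    refine Finset.sum_congr rfl fun ω _ => ?_
    rw [mul_assoc, Finset.sum_mul, Finset.mul_sum, Finset.mul_sum]
    exact Finset.sum_congr rfl fun η _ => by rw [hite]; ring
  rw [e1, e2]
  by_cases hδ : 0 < ∑ η, weight (fun e => (w e : ℝ)) η *
      ind {η' : BondConfig V | ∀ s ∈ S, ∀ t ∈ N, ¬ (openGraph η').Reachable s t} η
  · exact hardCore_cross_le_sum w S N (fun ω η =>
      if (∀ v ∈ N, ¬ ((∃ s ∈ S, (openGraph ω).Reachable s v) ∧ (∃ s ∈ S, (openGraph η).Reachable s v)))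
        then (1 : ℝ) else 0) (fun _ _ => rfl) hδ P Q hP hQ
  · -- degenerate weights: the left side vanishes
    have hδ0 : ∑ η, weight (fun e => (w e : ℝ)) η *
        ind {η' : BondConfig V | ∀ s ∈ S, ∀ t ∈ N, ¬ (openGraph η').Reachable s t} η = 0 :=
      le_antisymm (not_lt.1 hδ) (Finset.sum_nonneg fun η _ => mul_nonneg (hw0 η) (ind_nonneg _ η))
    have hzero := kernelMass_eq_zero_of_degenerate w S N (fun ω η =>
      if (∀ v ∈ N, ¬ ((∃ s ∈ S, (openGraph ω).Reachable s v) ∧ (∃ s ∈ S, (openGraph η).Reachable s v)))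
        then (1 : ℝ) else 0) (fun _ _ => rfl) hδ0
    have hχ0 : ∀ ω η : BondConfig V, (0 : ℝ) ≤
        (if (∀ v ∈ N, ¬ ((∃ s ∈ S, (openGraph ω).Reachable s v) ∧ (∃ s ∈ S, (openGraph η).Reachable s v)))
          then (1 : ℝ) else 0) := fun ω η => by split_ifs <;> norm_num
    have hP01 : ∀ E : Set (Sym2 V), (0 : ℝ) ≤ (if P E then (1 : ℝ) else 0) ∧ (if P E then (1 : ℝ) else 0) ≤ 1 :=
      fun E => by split_ifs <;> norm_num
    have hQ01 : ∀ E : Set (Sym2 V), (0 : ℝ) ≤ (if Q E then (1 : ℝ) else 0) ∧ (if Q E then (1 : ℝ) else 0) ≤ 1 :=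
      fun E => by split_ifs <;> norm_num
    calc _ ≤ ∑ ω, weight (fun e => (w e : ℝ)) ω * ∑ η, weight (fun e => (w e : ℝ)) η *
          (if (∀ v ∈ N, ¬ ((∃ s ∈ S, (openGraph ω).Reachable s v) ∧ (∃ s ∈ S, (openGraph η).Reachable s v)))
            then (1 : ℝ) else 0) := by
          refine Finset.sum_le_sum fun ω _ => mul_le_mul_of_nonneg_left ?_ (hw0 ω)
          have hin : ∀ η, weight (fun e => (w e : ℝ)) η * ((if Q (⋃ s ∈ S, openEdgeCluster η s) then (1 : ℝ) else 0) *
              (if (∀ v ∈ N, ¬ ((∃ s ∈ S, (openGraph ω).Reachable s v) ∧ (∃ s ∈ S, (openGraph η).Reachable s v)))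
                then (1 : ℝ) else 0)) ≤
              weight (fun e => (w e : ℝ)) η *
              (if (∀ v ∈ N, ¬ ((∃ s ∈ S, (openGraph ω).Reachable s v) ∧ (∃ s ∈ S, (openGraph η).Reachable s v)))
                then (1 : ℝ) else 0) := fun η => by
            nlinarith [hw0 η, hχ0 ω η, (hQ01 (⋃ s ∈ S, openEdgeCluster η s)).1,
              (hQ01 (⋃ s ∈ S, openEdgeCluster η s)).2, mul_nonneg (hw0 η) (hχ0 ω η)]
          have hsum := Finset.sum_le_sum fun η (_ : η ∈ Finset.univ) => hin η
          have hnn : 0 ≤ ∑ η, weight (fun e => (w e : ℝ)) η *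
              (if (∀ v ∈ N, ¬ ((∃ s ∈ S, (openGraph ω).Reachable s v) ∧ (∃ s ∈ S, (openGraph η).Reachable s v)))
                then (1 : ℝ) else 0) := Finset.sum_nonneg fun η _ => mul_nonneg (hw0 η) (hχ0 ω η)
          nlinarith [(hP01 (⋃ s ∈ S, openEdgeCluster ω s)).1, (hP01 (⋃ s ∈ S, openEdgeCluster ω s)).2,
            Finset.sum_nonneg fun η (_ : η ∈ Finset.univ) => le_trans (le_refl _) (mul_nonneg (hw0 η)
              (mul_nonneg (hQ01 (⋃ s ∈ S, openEdgeCluster η s)).1 (hχ0 ω η)))]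
      _ = 0 := Finset.sum_eq_zero fun ω _ => hzero ω
      _ ≤ _ := Finset.sum_nonneg fun ω _ => mul_nonneg (mul_nonneg (hw0 ω)
          (Finset.sum_nonneg fun η _ => mul_nonneg (hw0 η) (hχ0 ω η)))
          (mul_nonneg (hP01 _).1 (hQ01 _).1)

end Consts.TwoCopy

end Summit.CriticalPhenomena.PercolationContinuityZ3.Theorems

end
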